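import Literature.Computability.QuantumComplexity.GluedTreesThm9Graph

/-!
# `WbwObfuscatedGluedTrees` (stmt-QuantumAdvantage-2340) — II: the growth closure of the BPR template is one round

Support / negative lemma for the INFORMAL crux `WbwObfuscatedGluedTrees` of route
`Summits/QuantumAdvantage/QuantumAdvantage/Theses/WhiteBoxWalk`, extracted from the refuter work file
`Summits/QuantumAdvantage/QuantumAdvantage/Cruxes/WbwObfuscatedGluedTrees/Disproof.lean` (cycle 1,
refuter-cdisprove-stmt-QuantumAdvantage-2340-0). Sequel of `LoadBearing.lean` (I). Sorry-free; no
Theses decl is asserted; imports only the tree's glued-trees graph API.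

Content (`Percolation`): the growth rule of the Bitansky–Paneth–Rosen punctured-programming
template (FOCS 2015, §5, Claim 5.1(3–6): *the name of `v` may be punctured once every circuit input
that PRODUCES it is already dead*) is, for an UNDIRECTED neighbour circuit (every neighbour of `v`
outputs `name(v)`), bootstrap percolation with threshold = degree. Its closure is reached in ONE round
and equals `S ∪ {v | v has a neighbour ∧ N(v) ⊆ S}` (`oneRound_isGrowthClosed`,
`oneRound_subset_of_isGrowthClosed`, `sInter_isGrowthClosed_eq_oneRound`); for the glued trees
`exit_mem_oneRound_iff`: un-naming EXIT by growth steps forces a plant at EXIT itself or at BOTH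
children of EXIT (publicly labelled positions adjacent to the answer). Contrast `line_cascade`: on the
directed successor line (unique producer) a single plant kills the whole tail — BPR's one costly
plant + `T` cheap growth steps. This is the formal core of the route's kill criterion (b) ("a rigorous
no-go for kill-and-puncture chains on undirected bounded-degree succinct graphs"); the informal half —
plants at public labels are unaffordable for a key-holding reduction — is recorded in the crux's
Disproof.lean §4 and the item's evidence notes.
-/

set_option linter.dupNamespace false

namespace Summit.QuantumAdvantage.QuantumAdvantage.Theorems.WbwObfuscatedGluedTrees.Negative

open Literature.Computability.QuantumComplexity

/-! ## §3 Obstruction to the BPR15 plant-and-grow template: threshold-equals-degree percolation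

BPR15 (Sec. 5, Claim 5.1(3–6)) grow a planted dead set `S` by the rule: *the name of `v` can be
punctured (and `v` killed) once every input on which the circuit OUTPUTS that name is already dead*.
For a directed successor circuit the unique producer of `x_{i+1}` is `x_i`, so one plant kills the
whole tail (`line_cascade`). For an undirected neighbour circuit every neighbour of `v` produces
`name(v)`, the rule is bootstrap percolation with threshold = degree, and NOTHING CASCADES: the least
growth-closed superset of `S` is reached in one round and equals `S ∪ {v | N(v) ⊆ S}`. For `G'_n`,
EXIT dies only if it is planted or both its children are (`exit_mem_oneRound_iff`). -/

namespace Percolation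

variable {V : Type*} (G : SimpleGraph V)

/-- `T` is closed under the growth rule over the planted set `S`. [folklore] -/
def IsGrowthClosed (S T : Set V) : Prop :=
  S ⊆ T ∧ ∀ v, (∃ w, G.Adj v w) → (∀ w, G.Adj v w → w ∈ T) → v ∈ T

/-- One round of growth from `S`. [folklore] -/
def oneRound (S : Set V) : Set V :=
  S ∪ {v | (∃ w, G.Adj v w) ∧ ∀ w, G.Adj v w → w ∈ S}

/-- One round of growth is already growth-closed (no cascade). [folklore] -/
theorem oneRound_isGrowthClosed (S : Set V) : IsGrowthClosed G S (oneRound G S) := by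
  refine ⟨fun v hv => Or.inl hv, fun v hex hall => ?_⟩
  by_cases hvS : v ∈ S
  · exact Or.inl hvS
  · refine Or.inr ⟨hex, fun w hw => ?_⟩
    rcases hall w hw with hwS | ⟨_, hwall⟩
    · exact hwS
    · -- `w` died in round one, so all its neighbours, `v` included, are planted
      exact absurd (hwall v hw.symm) hvS

/-- One round of growth is contained in every growth-closed superset of `S`. [folklore] -/
theorem oneRound_subset_of_isGrowthClosed {S T : Set V} (h : IsGrowthClosed G S T) :
    oneRound G S ⊆ T := by
  rintro v (hv | ⟨hex, hall⟩)
  · exact h.1 hv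
  · exact h.2 v hex fun w hw => h.1 (hall w hw)

/-- **The growth closure is one round**: the least growth-closed superset of `S` is
`S ∪ {v | v has a neighbour and all its neighbours are in S}`. [folklore] -/
theorem sInter_isGrowthClosed_eq_oneRound (S : Set V) :
    ⋂₀ {T | IsGrowthClosed G S T} = oneRound G S := by
  apply le_antisymm
  · exact Set.sInter_subset_of_mem (oneRound_isGrowthClosed G S)
  · exact Set.subset_sInter fun T hT => oneRound_subset_of_isGrowthClosed G hT

open GluedTrees in
/-- **For the glued trees**: EXIT is in the growth closure of a planted set `S` iff EXIT is planted
or BOTH children of EXIT are (`1 ≤ n`) — un-naming EXIT by growth steps forces a plant at publicly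
labelled positions adjacent to the answer. [folklore] -/
theorem exit_mem_oneRound_iff {n : ℕ} (hn : 1 ≤ n) (σ : CycleDatum n) (S : Set (Vertex n)) :
    GluedTrees.exit n ∈ oneRound (graph n σ) S ↔
      GluedTrees.exit n ∈ S ∨ (childV (GluedTrees.exit n) false ∈ S ∧ childV (GluedTrees.exit n) true ∈ S) := by
  have h0 : depth (GluedTrees.exit n) < n := by simp; omega
  have hN : ∀ w, (graph n σ).Adj (GluedTrees.exit n) w ↔
      w = childV (GluedTrees.exit n) false ∨ w = childV (GluedTrees.exit n) true := by
    intro w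
    rw [← SimpleGraph.mem_neighborFinset, neighborFinset_of_depth_lt σ h0, if_pos depth_exit]
    simp
  unfold oneRound
  simp only [Set.mem_union, Set.mem_setOf_eq]
  constructor
  · rintro (h | ⟨_, hall⟩)
    · exact Or.inl h
    · exact Or.inr ⟨hall _ ((hN _).2 (Or.inl rfl)), hall _ ((hN _).2 (Or.inr rfl))⟩
  · rintro (h | ⟨h1, h2⟩)
    · exact Or.inl h
    · refine Or.inr ⟨⟨_, (hN _).2 (Or.inl rfl)⟩, fun w hw => ?_⟩
      rcases (hN w).1 hw with rfl | rfl
      · exact h1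
      · exact h2

/-- Directed growth (BPR's setting): `T` is closed if every vertex that HAS producers and all of whose
producers are dead is dead. [folklore] -/
def IsGrowthClosedDir (P : V → V → Prop) (S T : Set V) : Prop :=
  S ⊆ T ∧ ∀ v, (∃ w, P w v) → (∀ w, P w v → w ∈ T) → v ∈ T

/-- **Contrast: the directed line cascades.** On `0 → 1 → 2 → ⋯` (unique producer = predecessor),
every growth-closed superset of the single plant `{j}` contains the whole tail `{i | j ≤ i}` — BPR's
`T` cheap growth steps after one costly plant (Claim 5.1). [folklore] -/
theorem line_cascade (j : ℕ) (T : Set ℕ)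
    (h : IsGrowthClosedDir (fun i k : ℕ => k = i + 1) {j} T) :
    ∀ i : ℕ, j ≤ i → i ∈ T := by
  intro i hi
  induction i with
  | zero =>
    have hj : j = 0 := by omega
    subst hj
    exact h.1 rfl
  | succ i ih =>
    rcases Nat.lt_or_eq_of_le hi with hlt | heq
    · have hi' : i ∈ T := ih (by omega)
      refine h.2 (i + 1) ⟨i, rfl⟩ fun w hw => ?_
      obtain rfl : w = i := by
        simp only at hw
        omega
      exact hi'
    · rw [← heq]
      exact h.1 rfl

end Percolation


end Summit.QuantumAdvantage.QuantumAdvantage.Theorems.WbwObfuscatedGluedTrees.Negative
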